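import Literature.Combinatorics.Matroid.HeppBound
import Mathlib.Tactic.LinearCombination
import Mathlib.Algebra.BigOperators.Intervals
import Mathlib.Tactic.Ring
import Mathlib.Tactic.FieldSimp
import Mathlib.Algebra.BigOperators.Field
import HarnessLib

/-!
# Identities of the Hepp bound, I: the last-edge recursion and closed forms — proved

Proved consequences of Def. 2.4 [Panzer2022] for the pointwise Hepp sum `heppSumOfCorank` /
`heppBoundDim` of `Literature/Combinatorics/Matroid/HeppBound.lean`: bookkeeping on `orderings`,
the recursion over the last edge, and the closed forms for forests and cycles it yields
(Examples 2.5, 2.6, 2.10 and Cor. 2.20 of the source), which validate the definition. Duality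
(Prop. 4.5) and connectivity are in `HeppBoundDuality.lean`.

## Contents

* lemmas on `orderings` (nodup, length, support, reversal, last edge) and the **last-edge
  recursion** `heppSumOfCorank_eq_sum_erase`:
  `Hepp_D(E, a⃗) = Σ_{e ∈ E} Hepp_D(E ∖ e, a⃗) / ω(E ∖ e)` (`|E| ≥ 2`), `heppSumOfCorank_congr`,
  and the closed forms it yields: forests `(Σ a)/(Π a)` (Cor. 2.20 / Prop. 2.24), the bubble
  Ex. 2.5, the cycles `Hepp_D(C_N, a⃗) = (Σ a)/(Π a)` (Ex. 2.10, eq. (2.7)) and `H(C_N) = N`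
  (Ex. 2.6), for the uniform corank `uniformCorank` (Ex. 2.13),
-/

noncomputable section

open Finset

namespace Literature.Combinatorics.Matroid

variable {α : Type*} {𝕜 : Type*} [Field 𝕜]

/-- Lists enumerating a finset: no duplicates, the right length, the right support. [folklore] -/
theorem nodup_of_mem_orderings {E : Finset α} {l : List α} (hl : l ∈ orderings E) : l.Nodup := by
  rw [mem_orderings_iff] at hl
  have h := E.nodup
  rw [← hl, Multiset.coe_nodup] at h
  exact h

/-- An ordering of `E` has length `|E|`. [folklore] -/
theorem length_of_mem_orderings {E : Finset α} {l : List α} (hl : l ∈ orderings E) :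
    l.length = E.card := by
  rw [mem_orderings_iff] at hl
  rw [Finset.card, ← hl, Multiset.coe_card]

/-- The elements of an ordering of `E` are the elements of `E`. [folklore] -/
theorem mem_iff_of_mem_orderings {E : Finset α} {l : List α} (hl : l ∈ orderings E) {x : α} :
    x ∈ l ↔ x ∈ E := by
  rw [mem_orderings_iff] at hl
  rw [← Multiset.mem_coe, hl, Finset.mem_val]

/-- An ordering reversed is an ordering. [folklore] -/
theorem reverse_mem_orderings {E : Finset α} {l : List α} (hl : l ∈ orderings E) :
    l.reverse ∈ orderings E := by
  rw [mem_orderings_iff] at hl ⊢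
  rw [← hl]
  exact Multiset.coe_reverse l

/-- For an ordering `l` of `E`, the complement of the first `k` elements is the set of the
remaining ones: `E ∖ {l₁,…,l_k} = {l_{k+1},…,l_N}`. [folklore] -/
theorem sdiff_toFinset_take [DecidableEq α] {E : Finset α} {l : List α} (hl : l ∈ orderings E)
    (k : ℕ) : E \ (l.take k).toFinset = (l.drop k).toFinset := by
  have hnd := nodup_of_mem_orderings hl
  have hdisj : (l.take k).Disjoint (l.drop k) :=
    List.disjoint_of_nodup_append (by rwa [List.take_append_drop])
  ext x
  simp only [Finset.mem_sdiff, List.mem_toFinset, ← mem_iff_of_mem_orderings hl]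
  constructor
  · rintro ⟨hx, hxk⟩
    rw [← List.take_append_drop k l, List.mem_append] at hx
    exact hx.resolve_left hxk
  · intro hx
    exact ⟨List.mem_of_mem_drop hx, fun hxk => hdisj hxk hx⟩

/-- The support of an ordering of `E` is `E`. [folklore] -/
theorem toFinset_eq_of_mem_orderings [DecidableEq α] {E : Finset α} {l : List α}
    (hl : l ∈ orderings E) : l.toFinset = E := by
  ext x
  rw [List.mem_toFinset, mem_iff_of_mem_orderings hl]

/-- An ordering of a non-empty set is a non-empty list. [folklore] -/
theorem ne_nil_of_mem_orderings {E : Finset α} {l : List α} (hl : l ∈ orderings E)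
    (hE : E.Nonempty) : l ≠ [] := by
  rintro rfl
  have h := length_of_mem_orderings hl
  rw [List.length_nil] at h
  exact hE.card_pos.ne h

/-- Dropping the last edge of an ordering of `E` leaves an ordering of `E` minus that edge. [folklore] -/
theorem dropLast_mem_orderings_erase [DecidableEq α] {E : Finset α} {l : List α}
    (hl : l ∈ orderings E) (h : l ≠ []) :
    l.dropLast ∈ orderings (E.erase (l.getLast h)) := by
  have hnd := nodup_of_mem_orderings hl
  have hnotin : l.getLast h ∉ l.dropLast := by
    intro hmem
    rw [← List.dropLast_append_getLast h, List.nodup_append] at hnd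
    exact hnd.2.2 _ hmem _ (List.mem_singleton_self _) rfl
  have key : l.erase (l.getLast h) = l.dropLast := by
    nth_rewrite 1 [← List.dropLast_append_getLast h]
    rw [List.erase_append_right _ hnotin]
    simp
  rw [mem_orderings_iff] at hl ⊢
  rw [Finset.erase_val, ← hl, Multiset.coe_erase, key]

/-- Appending an edge `e ∈ E` to an ordering of `E ∖ e` gives an ordering of `E`. [folklore] -/
theorem concat_mem_orderings [DecidableEq α] {E : Finset α} {e : α} (he : e ∈ E) {l : List α}
    (hl : l ∈ orderings (E.erase e)) : l ++ [e] ∈ orderings E := by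
  rw [mem_orderings_iff] at hl ⊢
  rw [← Multiset.coe_add, hl, Finset.erase_val, Multiset.coe_singleton, add_comm,
    Multiset.singleton_add, Multiset.cons_erase (Finset.mem_def.1 he)]

/-- **Recursion of the Hepp sum over the last edge**: grouping the orderings of `E` by their
last edge `e`, the initial segments are orderings of `E ∖ e` followed by the full set `E ∖ e`,
so `Hepp_D(E, a⃗) = Σ_{e ∈ E} Hepp_D(E ∖ e, a⃗) / ω(E ∖ e)` for `|E| ≥ 2` (the corank of a
subset of `E ∖ e` is computed by the same `ℓ`; this is the grouping of Def. 2.4's sum used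
throughout Panzer 2022, e.g. in the proofs of Cor. 2.33 and Prop. 3.2). [cite: Panzer2022, Def. 2.4] -/
theorem heppSumOfCorank_eq_sum_erase [DecidableEq α] (ℓ : Finset α → ℕ) (E : Finset α)
    (hE : 2 ≤ E.card) (D : 𝕜) (a : α → 𝕜) :
    heppSumOfCorank ℓ E D a =
      ∑ e ∈ E, heppSumOfCorank ℓ (E.erase e) D a * (sdcOfCorank ℓ D a (E.erase e))⁻¹ := by
  have hEne : E.Nonempty := Finset.card_pos.1 (by omega)
  simp only [heppSumOfCorank_eq, Finset.sum_mul]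
  rw [Finset.sum_sigma']
  refine Finset.sum_bij' (fun l hl => ⟨l.getLast (ne_nil_of_mem_orderings hl hEne), l.dropLast⟩)
    (fun x _ => x.2 ++ [x.1]) ?_ ?_ ?_ ?_ ?_
  · intro l hl
    have hne := ne_nil_of_mem_orderings hl hEne
    exact Finset.mem_sigma.2 ⟨(mem_iff_of_mem_orderings hl).1 (List.getLast_mem hne),
      dropLast_mem_orderings_erase hl hne⟩
  · rintro ⟨e, l⟩ hx
    rw [Finset.mem_sigma] at hx
    exact concat_mem_orderings hx.1 hx.2
  · intro l hl
    exact List.dropLast_append_getLast _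
  · rintro ⟨e, l⟩ _
    simp
  · intro l hl
    have hne := ne_nil_of_mem_orderings hl hEne
    have hlen := length_of_mem_orderings hl
    have he : l.getLast hne ∈ E := (mem_iff_of_mem_orderings hl).1 (List.getLast_mem hne)
    have hdl : l.dropLast = l.take (E.card - 1) := by rw [List.dropLast_eq_take, hlen]
    dsimp only
    rw [Finset.card_erase_of_mem he]
    have hsplit : Finset.Ico 1 E.card = Finset.Ico 1 (E.card - 1 + 1) := by
      rw [Nat.sub_add_cancel (by omega)]
    rw [hsplit, Finset.prod_Ico_succ_top (by omega)]
    congr 1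
    · refine Finset.prod_congr rfl fun k hk => ?_
      rw [Finset.mem_Ico] at hk
      rw [hdl, List.take_take, min_eq_left (by omega)]
    · rw [← hdl, toFinset_eq_of_mem_orderings (dropLast_mem_orderings_erase hl hne)]

/-! ### Sanity checks: Examples 2.5 and 2.6 of Panzer 2022 -/

/-- The corank function of the **uniform matroid** `U_{n,r}`: a set of `k` elements has rank
`min(k, r)`, hence corank `k - min(k, r)` (Panzer 2022, Ex. 2.13; Mathlib at this pin has no
uniform matroids, so the function is recorded directly). [cite: Panzer2022, Ex. 2.13] -/
def uniformCorank (r : ℕ) (γ : Finset α) : ℕ :=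
  γ.card - min γ.card r

/-- Unfolding `uniformCorank`. [cite: Panzer2022, Ex. 2.13] -/
theorem uniformCorank_apply (r : ℕ) (γ : Finset α) :
    uniformCorank r γ = γ.card - min γ.card r := rfl

/-- **Example 2.5** (the bubble `C₂ ≅ U_{2,1}`): `Hepp_D(C₂, a⃗) = 1/a₁ + 1/a₂`, in every
dimension (the two orderings contribute `1/ω({e}) = 1/a_e`). [cite: Panzer2022, Ex. 2.5] -/
theorem heppSumOfCorank_bubble [DecidableEq α] {x y : α} (hxy : x ≠ y) (D : 𝕜) (a : α → 𝕜) :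
    heppSumOfCorank (uniformCorank 1) {x, y} D a = (a y)⁻¹ + (a x)⁻¹ := by
  have hex : ({x, y} : Finset α).erase x = {y} := Finset.erase_insert (by simpa using hxy)
  have hey : ({x, y} : Finset α).erase y = {x} := by
    rw [Finset.pair_comm]
    exact Finset.erase_insert (by simpa using hxy.symm)
  rw [heppSumOfCorank_eq_sum_erase _ _ (by rw [Finset.card_pair hxy]), Finset.sum_pair hxy,
    hex, hey]
  simp [sdcOfCorank, uniformCorank]

/-- The Hepp sum only depends on the corank of subsets of `E`. [folklore] -/
theorem heppSumOfCorank_congr [DecidableEq α] {ℓ ℓ' : Finset α → ℕ} {E : Finset α}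
    (h : ∀ γ, γ ⊆ E → ℓ γ = ℓ' γ) (D : 𝕜) (a : α → 𝕜) :
    heppSumOfCorank ℓ E D a = heppSumOfCorank ℓ' E D a := by
  simp only [heppSumOfCorank_eq]
  refine Finset.sum_congr rfl fun l hl => Finset.prod_congr rfl fun k _ => ?_
  have hsub : (l.take k).toFinset ⊆ E := by
    intro x hx
    rw [List.mem_toFinset] at hx
    exact (mem_iff_of_mem_orderings hl).1 (List.mem_of_mem_take hx)
  rw [sdcOfCorank_apply, sdcOfCorank_apply, h _ hsub]

/-- **Forests** (corank identically `0`, the free matroid `U_{m,m}`): in every dimension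
`Hepp_D(U_{m,m}, a⃗) = (a_1 + ⋯ + a_m)/(a_1 ⋯ a_m)` wherever the subset sums of the indices do
not vanish (so on the hyperplane `a_1 + ⋯ + a_m = 0` of logarithmic divergence it vanishes,
Panzer 2022, Ex. 2.7 and Cor. 2.20; the value itself is the shuffle identity
`Σ_σ Char(a_σ) = 1/(a_1⋯a_m)` of Prop. 2.24). [cite: Panzer2022, Cor. 2.20 with Prop. 2.24] -/
theorem heppSumOfCorank_corank_zero [DecidableEq α] :
    ∀ (n : ℕ) (E : Finset α), E.card = n + 1 → ∀ (D : 𝕜) (a : α → 𝕜),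
      (∀ γ, γ ⊆ E → γ.Nonempty → ∑ e ∈ γ, a e ≠ 0) →
        heppSumOfCorank (fun _ => 0) E D a = (∑ e ∈ E, a e) / ∏ e ∈ E, a e := by
  intro n
  induction n with
  | zero =>
    intro E hE D a ha
    obtain ⟨x, rfl⟩ := Finset.card_eq_one.1 hE
    have hx : a x ≠ 0 := by simpa using ha {x} subset_rfl (Finset.singleton_nonempty x)
    simp [hx]
  | succ n ih =>
    intro E hE D a ha
    have hae : ∀ e ∈ E, a e ≠ 0 := fun e he => by
      simpa using ha {e} (Finset.singleton_subset_iff.2 he) (Finset.singleton_nonempty e)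
    have hP : ∏ e ∈ E, a e ≠ 0 := Finset.prod_ne_zero_iff.2 hae
    rw [heppSumOfCorank_eq_sum_erase _ _ (by omega), Finset.sum_div]
    refine Finset.sum_congr rfl fun e he => ?_
    have hcard : (E.erase e).card = n + 1 := by rw [Finset.card_erase_of_mem he, hE]; rfl
    have hne : (E.erase e).Nonempty := Finset.card_pos.1 (by omega)
    have hS : ∑ f ∈ E.erase e, a f ≠ 0 := ha _ (Finset.erase_subset e E) hne
    rw [ih (E.erase e) hcard D a fun γ hγ hγne => ha γ (hγ.trans (Finset.erase_subset e E)) hγne,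
      sdcOfCorank_apply, Nat.cast_zero, mul_zero, sub_zero, ← Finset.mul_prod_erase E a he]
    have hPe : ∏ f ∈ E.erase e, a f ≠ 0 :=
      Finset.prod_ne_zero_iff.2 fun f hf => hae f (Finset.mem_of_mem_erase hf)
    have hae' := hae e he
    field_simp

/-- **Cycles** (`C_N ≅ U_{N,N-1}`, Panzer 2022, Ex. 2.10, eq. (2.7), first equality):
`Hepp_D(C_N, a⃗) = (a_1 + ⋯ + a_N)/(a_1 ⋯ a_N)` in every dimension, wherever the proper subset
sums of the indices do not vanish (every proper subgraph is a forest; with `ω(C_N) = 0` the right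
side is `(D/2)/(a_1⋯a_N)`). [cite: Panzer2022, Ex. 2.10] -/
theorem heppSumOfCorank_cycle [DecidableEq α] (E : Finset α) (hE : 2 ≤ E.card) (D : 𝕜)
    (a : α → 𝕜) (ha : ∀ γ, γ ⊆ E → γ.Nonempty → γ ≠ E → ∑ e ∈ γ, a e ≠ 0) :
    heppSumOfCorank (uniformCorank (E.card - 1)) E D a = (∑ e ∈ E, a e) / ∏ e ∈ E, a e := by
  have hae : ∀ e ∈ E, a e ≠ 0 := fun e he => by
    refine fun h0 => ha {e} (Finset.singleton_subset_iff.2 he) (Finset.singleton_nonempty e)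
      (fun hEe => ?_) (by simpa using h0)
    rw [← hEe, Finset.card_singleton] at hE
    omega
  rw [heppSumOfCorank_eq_sum_erase _ _ hE, Finset.sum_div]
  refine Finset.sum_congr rfl fun e he => ?_
  have hcardE : (E.erase e).card = (E.card - 2) + 1 := by rw [Finset.card_erase_of_mem he]; omega
  have hproper : ∀ γ, γ ⊆ E.erase e → γ ≠ E := by
    rintro γ hγ rfl
    exact (Finset.notMem_erase e γ) (hγ he)
  -- on subsets of `E ∖ e` the uniform corank `U_{N,N-1}` vanishes (they are forests)
  have hzero : ∀ γ, γ ⊆ E.erase e → uniformCorank (E.card - 1) γ = 0 := by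
    intro γ hγ
    have : γ.card ≤ E.card - 1 := by
      have := Finset.card_le_card hγ
      rw [Finset.card_erase_of_mem he] at this
      exact this
    rw [uniformCorank_apply, min_eq_left this, Nat.sub_self]
  rw [heppSumOfCorank_congr (fun γ hγ => hzero γ hγ) D a,
    heppSumOfCorank_corank_zero (E.card - 2) (E.erase e) hcardE D a
      (fun γ hγ hγne => ha γ (hγ.trans (Finset.erase_subset e E)) hγne (hproper γ hγ)),
    sdcOfCorank_apply, hzero _ subset_rfl, Nat.cast_zero, mul_zero, sub_zero,
    ← Finset.mul_prod_erase E a he]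
  have hS : ∑ f ∈ E.erase e, a f ≠ 0 :=
    ha _ (Finset.erase_subset e E) (Finset.card_pos.1 (by omega)) (hproper _ subset_rfl)
  have hPe : ∏ f ∈ E.erase e, a f ≠ 0 :=
    Finset.prod_ne_zero_iff.2 fun f hf => hae f (Finset.mem_of_mem_erase hf)
  have hae' := hae e he
  field_simp

/-- **Example 2.6**: with unit indices, `Hepp_D(C_N) = N` for every cycle, in every dimension
(and `= D/2` on the hyperplane of logarithmic divergence); over a field of characteristic `0`. [cite: Panzer2022, Ex. 2.6] -/
theorem heppSumOfCorank_cycle_one [DecidableEq α] [CharZero 𝕜] (E : Finset α) (hE : 2 ≤ E.card)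
    (D : 𝕜) : heppSumOfCorank (uniformCorank (E.card - 1)) E D (fun _ => 1) = E.card := by
  rw [heppSumOfCorank_cycle E hE D _ fun γ _ hγ _ => by
    rw [Finset.sum_const, nsmul_eq_mul, mul_one, Nat.cast_ne_zero]; exact hγ.card_pos.ne']
  simp

end Literature.Combinatorics.Matroid
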